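import Mathlib
import Summits.NavierStokesRegularity.NavierStokesRegularity.Theorems.RootDecompLitSliceMeanFieldLaggedEndpoint
import Summits.NavierStokesRegularity.NavierStokesRegularity.Theorems.RootDecompLitSliceMeanFieldLaggedAssembly
import Summits.NavierStokesRegularity.NavierStokesRegularity.Theorems.RootDecompLitSliceMeanFieldOneStep
import Summits.NavierStokesRegularity.NavierStokesRegularity.Theorems.RootDecompLitSliceMeanFieldEnergyDrop
import Summits.NavierStokesRegularity.NavierStokesRegularity.Theses.RootDecompLitSlice
import HarnessLib

/-!
# Route RootDecompLitSlice — crux Uᶜ `CritTameScarIsCritical` (stmt-NavierStokesRegularity-31733) CLOSED: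
# «a critically tame first blow-up has critical scars»

The two-level lagged term bound `hlag` of `MeanFieldLaggedEndpoint.energyHalfHolder_of_laggedEndpointBound`
(census g58, p838329) is DISCHARGED on Uᶜ's frame from the decomp-ns writer's one-step toolkit (g43):
the pairing identity against a fixed comparison slice (`MeanFieldPairing`, Galdi's Lemma 2.1 at the final time),
the energy drop through the comparison slice (`MeanFieldEnergyDrop.energyDrop_le`), the time-integrated flux
bound (`MeanFieldOneStep.abs_integral_flux_le`: Hölder `3·2·6`, `L³`-interpolation, Sobolev, window power
means) and the Chebyshev proxy slice (`MeanFieldTimeSide.exists_slice_dissipation_le`), assembled at the lag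
`σ = T − s = m(T − t)` by the census's `MeanFieldLaggedAssembly.laggedBound_of_termBounds` (p838476). Then
`MeanFieldLaggedEndpoint.critTameScarIsCritical_of_laggedEndpointBound` (invariant interval + lagged bootstrap,
p838279/p838329, + `EnergyClockScarLaw.halfHolderClockCell`) yields the route declaration
`Theses.RootDecompLitSlice.CritTameScarIsCritical` BY NAME.

* `laggedBound_of_sqrtClock` — classical Leray–Hopf frame + √-clock ⟹ `hlag` with `A = 2K`, `B = √2`,
  `c = 4 κ^{1/2}κ K^{1/4} ν^{−5/4}` (`κ` the whole-space Sobolev constant), on the window `(max T₁ 0, T)`.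
* `critTameScarIsCritical_proof : Theses.RootDecompLitSlice.CritTameScarIsCritical`.

HONEST FRAMING: Uᶜ is the Tao-vacuous, zero-load half of U = `NoSupercriticalTameScar` ⟨29565⟩
(U ⟺ Uᶜ ∧ Uᵃ by kernel); the load of the cell's blocker (ROOT ⟺ Uᵃ ∧ P1) is untouched. Rung 0: nothing here
proves NS regularity. [cite: Galdi2000, Lemma 2.1; ConstantinFoias1988, Ch. 6, Ch. 8]
-/

set_option linter.dupNamespace false

namespace Summit.NavierStokesRegularity.NavierStokesRegularity.Theorems

open MeasureTheory Set Filter Topology Function Module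
open scoped ENNReal NNReal RealInnerProductSpace
open Literature.Analysis.FluidPDE

namespace CritTameScarIsCriticalClosed

/-- ★ **The two-level lagged term bound on the √-clock class.** On the classical Leray–Hopf frame
(classical on `[0,T)`, Leray–Hopf on `[0,T]`) with the critical clock `∫|u t − u T|² ≤ K√(T−t)` on
`(T₁, T)`: for every lag `m ≥ 1` and all `max T₁ 0 < s < t < T` with `T − s = m(T − t)`, the window level
`φ₁ = D(t)/√(T−t)` is bounded by the proxy level `φ₀ = D(s)/√(T−s)` (`D = ∫‖u ·‖² − ∫‖u T‖²`) in the shape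
`φ₁ ≤ A(1+m^{1/4}) + (B/m^{1/4})φ₀^{1/2}φ₁^{1/2} + (c/m^{1/8})φ₀^{1/2}φ₁^{3/4} + (c/m^{1/4})φ₀^{3/4}φ₁^{1/2}`,
`A = 2K`, `B = √2`, `c = 4κ^{1/2}κ K^{1/4}/ν^{5/4}` (comparison slice `u s₀`, `s₀ ∈ (s, (s+T)/2)` by Chebyshev;
energy drop through it; pairing identity + flux bound; assembly algebra `laggedBound_of_termBounds`).
[folklore] -/
theorem laggedBound_of_sqrtClock (ν T : ℝ) (hν : 0 < ν) (hT : 0 < T)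
    (u : ℝ → EuclideanSpace ℝ (Fin 3) → EuclideanSpace ℝ (Fin 3)) (p : ℝ → EuclideanSpace ℝ (Fin 3) → ℝ)
    (hcl : IsClassicalNSSolutionOn (Ico 0 T) ν 0 u p) (hLH : IsLerayHopfOn T ν 0 (u 0) u)
    (hclock : ∃ K T₁ : ℝ, T₁ < T ∧ ∀ t ∈ Ioo T₁ T,
      ∫⁻ x, ‖u t x - u T x‖ₑ ^ 2 ≤ ENNReal.ofReal (K * Real.sqrt (T - t))) :
    ∃ A B c T₁ : ℝ, 0 ≤ A ∧ 0 ≤ B ∧ 0 ≤ c ∧ T₁ < T ∧ ∀ m : ℝ, 1 ≤ m →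
      ∀ s ∈ Ioo T₁ T, ∀ t ∈ Ioo s T, T - s = m * (T - t) →
      ((∫ x, ‖u t x‖ ^ 2) - ∫ x, ‖u T x‖ ^ 2) / Real.sqrt (T - t) ≤
        A * (1 + m ^ (1 / 4 : ℝ))
        + B / m ^ (1 / 4 : ℝ) *
          ((((∫ x, ‖u s x‖ ^ 2) - ∫ x, ‖u T x‖ ^ 2) / Real.sqrt (T - s)) ^ (1 / 2 : ℝ) *
            (((∫ x, ‖u t x‖ ^ 2) - ∫ x, ‖u T x‖ ^ 2) / Real.sqrt (T - t)) ^ (1 / 2 : ℝ))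
        + c / m ^ (1 / 8 : ℝ) *
          ((((∫ x, ‖u s x‖ ^ 2) - ∫ x, ‖u T x‖ ^ 2) / Real.sqrt (T - s)) ^ (1 / 2 : ℝ) *
            (((∫ x, ‖u t x‖ ^ 2) - ∫ x, ‖u T x‖ ^ 2) / Real.sqrt (T - t)) ^ (3 / 4 : ℝ))
        + c / m ^ (1 / 4 : ℝ) *
          ((((∫ x, ‖u s x‖ ^ 2) - ∫ x, ‖u T x‖ ^ 2) / Real.sqrt (T - s)) ^ (3 / 4 : ℝ) *
            (((∫ x, ‖u t x‖ ^ 2) - ∫ x, ‖u T x‖ ^ 2) / Real.sqrt (T - t)) ^ (1 / 2 : ℝ)) := by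
  obtain ⟨K, T₁, hT₁, hK⟩ := hclock
  -- a nonnegative clock constant
  obtain ⟨K', hK'def⟩ : ∃ K' : ℝ, K' = max K 0 := ⟨_, rfl⟩
  have hK'0 : 0 ≤ K' := by rw [hK'def]; exact le_max_right _ _
  have hK' : ∀ t ∈ Ioo T₁ T, ∫⁻ x, ‖u t x - u T x‖ₑ ^ 2 ≤ ENNReal.ofReal (K' * Real.sqrt (T - t)) :=
    fun t ht => (hK t ht).trans (ENNReal.ofReal_le_ofReal
      (mul_le_mul_of_nonneg_right (by rw [hK'def]; exact le_max_left _ _) (Real.sqrt_nonneg _)))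
  -- the Sobolev constant and the transport coefficient
  obtain ⟨κ, hκ⟩ : ∃ κ : ℝ, κ = (SNormLESNormFDerivOfEqConst (EuclideanSpace ℝ (Fin 3))
    (volume : Measure (EuclideanSpace ℝ (Fin 3))) 2 : ℝ) := ⟨_, rfl⟩
  have hκ0 : 0 ≤ κ := by rw [hκ]; exact NNReal.coe_nonneg _
  obtain ⟨C, hCdef⟩ : ∃ C : ℝ, C = κ ^ (1 / 2 : ℝ) * κ := ⟨_, rfl⟩
  have hC0 : 0 ≤ C := by rw [hCdef]; exact mul_nonneg (Real.rpow_nonneg hκ0 _) hκ0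
  -- the window
  obtain ⟨T₀, hT₀def⟩ : ∃ T₀ : ℝ, T₀ = max T₁ 0 := ⟨_, rfl⟩
  have hT₀T : T₀ < T := by rw [hT₀def]; exact max_lt hT₁ hT
  have hT₀1 : T₁ ≤ T₀ := by rw [hT₀def]; exact le_max_left _ _
  have hT₀0 : 0 ≤ T₀ := by rw [hT₀def]; exact le_max_right _ _
  refine ⟨2 * K', Real.sqrt 2, 4 * C * K' ^ (1 / 4 : ℝ) / ν ^ (5 / 4 : ℝ), T₀, by positivity,
    Real.sqrt_nonneg _, by positivity, hT₀T, ?_⟩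
  intro m hm s hs t ht hst
  -- the two scales
  have hs0 : 0 < s := lt_of_le_of_lt hT₀0 hs.1
  have hsI : s ∈ Ioo 0 T := ⟨hs0, hs.2⟩
  have htI : t ∈ Ioo 0 T := ⟨hs0.trans ht.1, ht.2⟩
  have hs1 : s ∈ Ioo T₁ T := ⟨lt_of_le_of_lt hT₀1 hs.1, hs.2⟩
  have ht1 : t ∈ Ioo T₁ T := ⟨hs1.1.trans ht.1, ht.2⟩
  set τ : ℝ := T - t with hτdef
  set σ : ℝ := T - s with hσdef
  have hτ : 0 < τ := by rw [hτdef]; linarith [ht.2]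
  have hσ : 0 < σ := by rw [hσdef]; linarith [hs.2]
  have hσT : σ ≤ T := by rw [hσdef]; linarith
  have hτσ : τ ≤ σ := by
    rw [hst]; exact le_mul_of_one_le_left hτ.le hm
  -- the two energy levels
  set D₀ : ℝ := (∫ x, ‖u s x‖ ^ 2) - ∫ x, ‖u T x‖ ^ 2 with hD₀def
  set D₁ : ℝ := (∫ x, ‖u t x‖ ^ 2) - ∫ x, ‖u T x‖ ^ 2 with hD₁def
  have hD₀ : 0 ≤ D₀ := by
    have := MeanFieldTimeSide.energy_antitone hν hcl hLH hs0.le hs.2.le le_rfl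
    rw [hD₀def]; linarith
  have hD₁ : 0 ≤ D₁ := by
    have := MeanFieldTimeSide.energy_antitone hν hcl hLH htI.1.le ht.2.le le_rfl
    rw [hD₁def]; linarith
  -- the comparison slice (Chebyshev) and its dissipation level `G² ≤ D₀/(νσ)`
  obtain ⟨s₀, hs₀, hF₀⟩ := MeanFieldTimeSide.exists_slice_dissipation_le hν hT hcl hLH hσ hσT
  have hTσs : T - σ = s := by rw [hσdef]; ring
  rw [hTσs] at hs₀ hF₀
  have hs₀I : s₀ ∈ Ioo 0 T := ⟨hs0.trans hs₀.1, by linarith [hs₀.2]⟩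
  have hs₀1 : s₀ ∈ Ioo T₁ T := ⟨hs1.1.trans hs₀.1, hs₀I.2⟩
  have hTs₀ : T - s₀ ≤ σ := by rw [hσdef]; linarith [hs₀.1]
  set mw : ℝ := D₀ / (ν * σ) with hmwdef
  have hmw0 : 0 ≤ mw := by positivity
  have hM : (∫⁻ x, ENNReal.ofReal (frobeniusNormSq (fderiv ℝ (u s₀) x))) ≤ ENNReal.ofReal mw := hF₀
  have hMfin : (∫⁻ x, ENNReal.ofReal (frobeniusNormSq (fderiv ℝ (u s₀) x))) ≠ ⊤ :=
    (hM.trans_lt ENNReal.ofReal_lt_top).ne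
  set G : ℝ := mw ^ (1 / 2 : ℝ) with hGdef
  have hG : 0 ≤ G := Real.rpow_nonneg hmw0 _
  -- the `L²`-closeness of the window slices to the comparison slice: `S = 2√K·√√σ`
  set S : ℝ := 2 * Real.sqrt K' * Real.sqrt (Real.sqrt σ) with hSdef
  have hS0 : 0 ≤ S := by positivity
  have eLp_le : ∀ {f : EuclideanSpace ℝ (Fin 3) → EuclideanSpace ℝ (Fin 3)} {c₀ : ℝ}, 0 ≤ c₀ →
      (∫⁻ x, ‖f x‖ₑ ^ 2 ≤ ENNReal.ofReal c₀) → eLpNorm f 2 volume ≤ ENNReal.ofReal (Real.sqrt c₀) := by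
    intro f c₀ hc₀ h
    rw [eLpNorm_eq_lintegral_rpow_enorm_toReal two_ne_zero ENNReal.ofNat_ne_top, ENNReal.toReal_ofNat,
      Real.sqrt_eq_rpow, ← ENNReal.ofReal_rpow_of_nonneg hc₀ (by norm_num)]
    refine ENNReal.rpow_le_rpow ?_ (by norm_num)
    refine le_of_eq_of_le (lintegral_congr fun x => ?_) h
    rw [show (2 : ℝ) = (2 : ℕ) by norm_num, ENNReal.rpow_natCast]
  have hclk : ∀ r ∈ Ioo T₁ T, T - r ≤ σ →
      eLpNorm (fun x => u r x - u T x) 2 volume ≤ ENNReal.ofReal (Real.sqrt K' * Real.sqrt (Real.sqrt σ)) := by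
    intro r hr hrσ
    have hTr : 0 ≤ T - r := by linarith [hr.2]
    refine (eLp_le (by positivity) (hK' r hr)).trans (ENNReal.ofReal_le_ofReal ?_)
    rw [Real.sqrt_mul hK'0]
    exact mul_le_mul_of_nonneg_left (Real.sqrt_le_sqrt (Real.sqrt_le_sqrt hrσ)) (Real.sqrt_nonneg _)
  have hmeas : ∀ r ∈ Icc 0 T, AEStronglyMeasurable (u r) volume := fun r hr => (hLH.memLp r hr).1
  have hL : ∀ r ∈ Ioo t T, eLpNorm (fun x => u r x - u s₀ x) 2 volume ≤ ENNReal.ofReal S := by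
    intro r hr
    have hr1 : r ∈ Ioo T₁ T := ⟨ht1.1.trans hr.1, hr.2⟩
    have hrσ : T - r ≤ σ := by linarith [hr.1]
    have hsplit : (fun x => u r x - u s₀ x) = fun x => (u r x - u T x) + (u T x - u s₀ x) := by
      funext x; rw [sub_add_sub_cancel]
    have hneg : (fun x => u T x - u s₀ x) = -(fun x => u s₀ x - u T x) := by
      funext x; simp
    have h1 := hclk r hr1 hrσ
    have h2 : eLpNorm (fun x => u T x - u s₀ x) 2 volume ≤
        ENNReal.ofReal (Real.sqrt K' * Real.sqrt (Real.sqrt σ)) := by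
      rw [hneg, eLpNorm_neg]; exact hclk s₀ hs₀1 hTs₀
    rw [hsplit]
    refine (eLpNorm_add_le ((hmeas r ⟨(htI.1.trans hr.1).le, hr.2.le⟩).sub (hmeas T ⟨hT.le, le_rfl⟩))
      ((hmeas T ⟨hT.le, le_rfl⟩).sub (hmeas s₀ ⟨hs₀I.1.le, hs₀I.2.le⟩)) (by norm_num)).trans ?_
    rw [hSdef, show 2 * Real.sqrt K' * Real.sqrt (Real.sqrt σ) =
      Real.sqrt K' * Real.sqrt (Real.sqrt σ) + Real.sqrt K' * Real.sqrt (Real.sqrt σ) by ring,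
      ENNReal.ofReal_add (by positivity) (by positivity)]
    exact add_le_add h1 h2
  -- the two master inequalities of the toolkit
  have hE := MeanFieldEnergyDrop.energyDrop_le hν hT hcl hLH htI hs₀I hMfin
    (α := K' * Real.sqrt τ) (β := K' * Real.sqrt σ) (by positivity) (by positivity) (hK' t ht1)
    ((hK' s₀ hs₀1).trans (ENNReal.ofReal_le_ofReal
      (mul_le_mul_of_nonneg_left (Real.sqrt_le_sqrt hTs₀) hK'0)))
  have hF := MeanFieldOneStep.abs_integral_flux_le hν hcl hLH htI hs₀I hMfin hS0 hmw0 hD₁ hL hM le_rfl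
  rw [← hκ] at hF
  -- the raw quantities of the assembly algebra
  set W : ℝ := D₁ / (2 * ν) with hWdef
  have hW0 : 0 ≤ W := by positivity
  set I₁ : ℝ := τ ^ (1 / 2 : ℝ) * W ^ (1 / 2 : ℝ) with hI₁def
  set I : ℝ := τ ^ (1 / 4 : ℝ) * W ^ (3 / 4 : ℝ) with hIdef
  have hI₁0 : 0 ≤ I₁ := mul_nonneg (Real.rpow_nonneg hτ.le _) (Real.rpow_nonneg hW0 _)
  have hI0 : 0 ≤ I := mul_nonneg (Real.rpow_nonneg hτ.le _) (Real.rpow_nonneg hW0 _)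
  -- radicals as real powers
  have e_sqrt : ∀ {x : ℝ}, Real.sqrt x = x ^ (1 / 2 : ℝ) := fun {x} => Real.sqrt_eq_rpow x
  have e_S : Real.sqrt S = S ^ (1 / 2 : ℝ) := e_sqrt
  have e_G : Real.sqrt G = mw ^ (1 / 4 : ℝ) := by
    rw [hGdef, Real.sqrt_eq_rpow, ← Real.rpow_mul hmw0]; norm_num
  have e_G2 : G ^ 2 = mw := by
    rw [hGdef, ← Real.rpow_mul_natCast hmw0]; norm_num
  have e_α : Real.sqrt (K' * Real.sqrt τ) * Real.sqrt (K' * Real.sqrt σ) =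
      K' * Real.sqrt (Real.sqrt τ) * Real.sqrt (Real.sqrt σ) := by
    rw [Real.sqrt_mul hK'0, Real.sqrt_mul hK'0]
    have : Real.sqrt K' * Real.sqrt K' = K' := Real.mul_self_sqrt hK'0
    calc Real.sqrt K' * Real.sqrt (Real.sqrt τ) * (Real.sqrt K' * Real.sqrt (Real.sqrt σ))
        = (Real.sqrt K' * Real.sqrt K') * Real.sqrt (Real.sqrt τ) * Real.sqrt (Real.sqrt σ) := by ring
      _ = K' * Real.sqrt (Real.sqrt τ) * Real.sqrt (Real.sqrt σ) := by rw [this]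
  have e_τ4 : Real.sqrt (Real.sqrt τ) = τ ^ (1 / 4 : ℝ) := by
    rw [Real.sqrt_eq_rpow, Real.sqrt_eq_rpow, ← Real.rpow_mul hτ.le]; norm_num
  have e_W34 : Real.sqrt W * Real.sqrt (Real.sqrt W) = W ^ (3 / 4 : ℝ) := by
    rw [Real.sqrt_eq_rpow, Real.sqrt_eq_rpow, ← Real.rpow_mul hW0, ← Real.rpow_add' hW0 (by norm_num)]
    norm_num
  -- the term bounds in the assembly's shape
  have h0 : D₁ ≤ K' * Real.sqrt τ + 2 * (Real.sqrt (K' * Real.sqrt τ) * Real.sqrt (K' * Real.sqrt σ)) +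
      2 * (ν * G * I₁) + 2 * (C * (G * Real.sqrt S * I + G * Real.sqrt G * Real.sqrt S * I₁)) := by
    have hTT : S ^ (1 / 2 : ℝ) * κ ^ (1 / 2 : ℝ) * mw ^ (1 / 2 : ℝ) * κ *
        (τ ^ (1 / 4 : ℝ) * (D₁ / (2 * ν)) ^ (3 / 4 : ℝ) +
          mw ^ (1 / 4 : ℝ) * (τ ^ (1 / 2 : ℝ) * (D₁ / (2 * ν)) ^ (1 / 2 : ℝ))) +
        ν * mw ^ (1 / 2 : ℝ) * (τ ^ (1 / 2 : ℝ) * (D₁ / (2 * ν)) ^ (1 / 2 : ℝ)) =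
        ν * G * I₁ + C * (G * Real.sqrt S * I + G * Real.sqrt G * Real.sqrt S * I₁) := by
      rw [e_S, e_G, hCdef, hGdef, hIdef, hI₁def, hWdef]; ring
    have hF' : |∫ r in Ioo t T, ((∫ x, ⟪convect (u r) (u s₀) x, u r x⟫) -
        ν * ∑ i, ∫ x, ⟪fderiv ℝ (u r) x (stdOrthonormalBasis ℝ _ i),
          fderiv ℝ (u s₀) x (stdOrthonormalBasis ℝ _ i)⟫)| ≤
        ν * G * I₁ + C * (G * Real.sqrt S * I + G * Real.sqrt G * Real.sqrt S * I₁) := by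
      rw [← hTT]; exact hF
    have hE' : D₁ ≤ K' * Real.sqrt τ + 2 * (Real.sqrt (K' * Real.sqrt τ) * Real.sqrt (K' * Real.sqrt σ)) +
        2 * |∫ r in Ioo t T, ((∫ x, ⟪convect (u r) (u s₀) x, u r x⟫) -
          ν * ∑ i, ∫ x, ⟪fderiv ℝ (u r) x (stdOrthonormalBasis ℝ _ i),
            fderiv ℝ (u s₀) x (stdOrthonormalBasis ℝ _ i)⟫)| := hE
    linarith [hE', hF']
  have h1 : Real.sqrt (K' * Real.sqrt τ) * Real.sqrt (K' * Real.sqrt σ) ≤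
      K' * Real.sqrt (Real.sqrt τ) * Real.sqrt (Real.sqrt σ) := e_α.le
  have c1 : G ^ 2 ≤ D₀ / (ν * σ) := by rw [e_G2]
  have c2 : S ≤ 2 * Real.sqrt K' * Real.sqrt (Real.sqrt σ) := le_rfl
  have c3 : W ≤ D₁ / (2 * ν) := le_rfl
  have c4 : I₁ ≤ Real.sqrt τ * Real.sqrt W := by
    rw [hI₁def, e_sqrt, e_sqrt]
  have c5 : I ≤ Real.sqrt (Real.sqrt τ) * (Real.sqrt W * Real.sqrt (Real.sqrt W)) := by
    rw [hIdef, e_τ4, e_W34]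
  have key := MeanFieldLaggedAssembly.laggedBound_of_termBounds (K := K') (ν := ν) (C := C) (m := m)
    (τ := τ) (σ := σ) (D₀ := D₀) (D₁ := D₁) (G := G) (S := S) (W := W) (I₁ := I₁) (I := I)
    (T₁ := Real.sqrt (K' * Real.sqrt τ) * Real.sqrt (K' * Real.sqrt σ)) (T₂ := C * (G * Real.sqrt S * I +
      G * Real.sqrt G * Real.sqrt S * I₁)) (T₃ := ν * G * I₁)
    hK'0 hν hC0 hm hτ hst hD₀ hD₁ hG hI₁0 hI0 h0 h1 le_rfl le_rfl c1 c2 c3 c4 c5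
  exact key

/-- ★ **Uᶜ ⟨31733⟩ — `CritTameScarIsCritical` — PROVED.** A maximal smooth finite-energy solution
(Leray–Hopf from a decaying datum) which is tame at the blow-up time `T` with the critical clock
`∫|u(t)−u(T)|² ≤ K√(T−t)` has critical scars: `sup_{r<r₁} r⁻¹∫_{B_r(x₀)}|u(T)|² < ∞` at every `x₀`.
Proof: `laggedBound_of_sqrtClock` (the writer's one-step toolkit at the lag `σ = m(T−t)`, assembled by
`MeanFieldLaggedAssembly.laggedBound_of_termBounds`) feeds the cell form
`MeanFieldLaggedEndpoint.critTameScarIsCritical_of_laggedEndpointBound` (invariant interval + lagged bootstrap ⟹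
energy-Type-I ⟹ `EnergyClockScarLaw.halfHolderClockCell`). [folklore] -/
theorem critTameScarIsCritical_proof : Theses.RootDecompLitSlice.CritTameScarIsCritical := by
  intro ν T hν hT u p hmax hLH hdec htame hclock x₀
  exact MeanFieldLaggedEndpoint.critTameScarIsCritical_of_laggedEndpointBound ν T hν hT u p hmax hLH hdec
    htame hclock (laggedBound_of_sqrtClock ν T hν hT u p hmax.1 hLH hclock) x₀

end CritTameScarIsCriticalClosed

end Summit.NavierStokesRegularity.NavierStokesRegularity.Theorems
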